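import Summits.ResolutionOfSingularities.ResolutionOfSingularities.Theorems.MarkedTransferCampaignW46IsolatedThread
import HarnessLib

/-!
# [OURS · L1 W4.6 rung (i-a)] The two local forms compared: a local exit bound excludes hit threads
# (cell res-hironaka, LADDER-RESOLUTION rung L, D-0089; campaign s46, prover res-L1-s46-pv-1; host route
# MarkedTransfer, `--supports stmt-ResolutionOfSingularities-16155`)

HONEST FRAMING. Nothing here is a statement of H. Hironaka's manuscript (2017-03-23, [Hironaka2017]). Pure logic
over this seat's companion modules: `MarkedTransferCampaignW46PlaneIsolated` reduces rung (i-a) to the UNIFORM local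
statement `LocalExitBound` (a bound `β(A, E, x)` on the stages whose centre meets the fibre over `x`), and
`MarkedTransferCampaignW46IsolatedThread` reduces it to the NON-UNIFORM one `NoHitThread` (no chain of infinitely
near singular points blown up infinitely often). Here: **`LocalExitBound Rg → NoHitThread Rg`** — along a hit thread
`y`, every hit stage has its centre `{y k}` over the point `y 0` of stage `0` (`HitThread.down_y`), so the hits are
bounded by `β(A₀, E₀, y 0)`; hence the thread form is the WEAKER (easier) target, and either suffices for the rung
(`planeIsolatedPermissiblyTerminates_of_noHitThread`, `…_of_localExitBound`). AI review is weaker than expert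
review. No `sorry`; axioms standard.
-/

noncomputable section

set_option linter.dupNamespace false -- mandated namespace of this single-conjunct summit

open CategoryTheory AlgebraicGeometry TopologicalSpace

namespace Summit.ResolutionOfSingularities.ResolutionOfSingularities.Theorems

namespace CampaignW46

open Literature.AlgebraicGeometry.Resolution
open Literature.AlgebraicGeometry.Hironaka2017.S02Preliminaries

universe u

variable {p : ℕ} [Fact p.Prime] {K : Type u} [Field K] [CharP K p]

namespace PermissibleRun

variable {r : PermissibleRun p K} (t : r.HitThread)

/-- Along a thread, the point of stage `k` lies over the point of stage `0`. [folklore] -/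
theorem HitThread.down_y : ∀ k, r.down k (t.y k) = t.y 0
  | 0 => rfl
  | k + 1 => by rw [r.down_succ_apply, t.compat k]; exact HitThread.down_y k

/-- Along a hit thread there are finite sets of hit stages of every size. [folklore] -/
theorem HitThread.exists_finset_hits (n : ℕ) :
    ∃ s : Finset ℕ, s.card = n ∧ ∀ m ∈ s, (r.D m : Set (r.A m).Z) = {t.y m} := by
  classical
  have hinf : {m : ℕ | (r.D m : Set (r.A m).Z) = {t.y m}}.Infinite := by
    refine Set.infinite_of_forall_exists_gt fun k₀ => ?_
    obtain ⟨k, hk, hDk⟩ := t.hit (k₀ + 1)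
    exact ⟨k, hDk, by omega⟩
  obtain ⟨s, hs, hcard⟩ := hinf.exists_subset_card_eq n
  exact ⟨s, hcard, fun m hm => hs hm⟩

end PermissibleRun

/-- **A local exit bound excludes hit threads** (pure logic): the hits of a thread `y` are stages whose centre
`{y m}` meets (indeed lies in) the fibre over `y 0`, so at most `β(A₀, E₀, y 0)` of them exist. [folklore] -/
theorem noHitThread_of_localExitBound {Rg : Regime p K} (h : LocalExitBound Rg) : NoHitThread Rg := by
  intro r hr t
  obtain ⟨β, hβ⟩ := h
  obtain ⟨s, hcard, hs⟩ := t.exists_finset_hits (β (r.A 0) (r.E 0) (t.y 0) + 1)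
  have hle := hβ r hr (t.y 0) s fun m hm =>
    ⟨t.y m, by rw [hs m hm]; exact Set.mem_singleton _, t.down_y m⟩
  omega

/-- The same in the regime of rung (i-a). [folklore] -/
theorem planeIsolatedNoHitThread_of_localExitBound (h : PlaneIsolatedLocalExitBound p K) :
    PlaneIsolatedNoHitThread p K :=
  noHitThread_of_localExitBound h

end CampaignW46

end Summit.ResolutionOfSingularities.ResolutionOfSingularities.Theorems

end
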